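import Literature.AnabelianGeometry.SemiGraphs.ProSigmaSurfaceCharacters
import HarnessLib

/-!
# Pro-`Σ` completions of closed surface groups are slim, modulo F_cov ([AbsAnab] Lemma 1.3.1, proper case)

[AbsAnab] (Mochizuki, *The absolute anabelian geometry of hyperbolic curves*, 2004) Lemma 1.3.1 p. 15
[cite: MochizukiAbsAnab2004, Lemma 1.3.1 p.15]: the pro-`Σ` geometric fundamental group of a hyperbolic
curve is slim; [SemiAnbd] Example 2.10 p. 31 uses it for the vertex groups of a semi-graph of anabelioids
of a pointed stable curve ("verticially slim") [cite: MochizukiSemiAnbd2006, Ex. 2.10 p.31].  The affine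
case (free `π₁`) is abc-iut-L5-t9's `ProSigmaCompletionSlim.lean`; `ProSigmaPuncturedSlim.lean` reduced the
named fact `ProSigmaSurfaceGroupSlim` (abc-iut-L3-t11) to the CLOSED-SURFACE CASE `h0`: every pro-`Σ`
completion of `Γ_{g,0} = S_g`, `g ≥ 2`, is slim.  This file PROVES `h0` MODULO ONE classical input, the
tree's named fact `SurfaceGroupFiniteIndexSubgroup` ("F_cov": a finite-index subgroup of `S_g` is an
`S_h`, `h = j (g - 1) + 1`; Zieschang–Vogt–Coldewey 4.14.22).

Route (no cohomological degree formula is used):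
* Oort's reduction and abc-iut-L5-t9's `restrict_isOpen`: it suffices that every pro-`Σ` completion of
  every `S_h`, `h ≥ 2`, be CENTER-FREE (an open `W ∋ z` with `z ∈ Z_P(H)` central has `ι⁻¹(W) ≅ S_h` by
  F_cov);
* separation and the basis character (`ProSigmaCentralPairs.lean`, with the abelianisation characters of
  two standard generators): a central `z ≠ 1` yields a prime `p ∈ Σ`, an open `U ∋ τ = ι(a)`, an element
  `κ ∈ U` commuting with `τ`, and a continuous `ψ : U → 𝔽_p²` with `ψτ = (1,0)`, `ψκ = (0,1)`;
* the character space and shrinking (`ProSigmaSurfaceCharacters.lean`): WLOG `ι⁻¹(U) ≅ S_{h'}`, `h' ≥ 3`,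
  with `𝔽_p`-linear evaluation functionals `E₁, E₂` on `𝔽_p^{2h'} =` characters of `S_{h'}` (= continuous
  characters of `U`);
* the isotropic-pair lemma (`SurfaceGroupIsotropicCharacterPairs.lean`): some pair of characters with
  `(E₁, E₂)`-values `(1,0)`, `(0,1)` has vanishing Heisenberg obstruction, hence lifts to the extraspecial
  group `E` of order `p³` (a `Σ`-group); the lift extends continuously to `U`, and the commuting `τ, κ`
  acquire commuting lifts of `(1,0)`, `(0,1)` in `E` — impossible.

Main results: `isSlimGroup_of_surfaceGroup (hF)`, `isSlimGroup_of_isProSigmaCompletion_closedSurfaceGroup`,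
`proSigmaSurfaceGroupSlim_of_finiteIndexSubgroup (hF) : ProSigmaSurfaceGroupSlim`, and [SemiAnbd]
Ex. 2.10 conjunct (5) for every semi-graph of anabelioids of surface type modulo F_cov only
(`example_2_10_verticiallySlim_of_finiteIndexSubgroup`).  CONDITIONAL on the named fact F_cov (typed ≠
proved for it); theorems only; nothing here bears on [IUTchIII] Cor. 3.12.
-/

noncomputable section

namespace Literature.AnabelianGeometry.SemiGraphs.SemiGraphOfAnabelioids.IsProSigmaCompletion

open Literature.AnabelianGeometry.Anabelioids Literature.AlgebraicGeometry.Frobenioids Topology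
open Multiplicative
open Literature.GroupTheory.CombinatorialGroupTheory
open Literature.Topology.FourManifolds (SurfaceGroup surfaceGen surfaceRelator)

universe u v₁ u₁

variable {Sigma : Set ℕ} {Γ : Type*} [Group Γ] {P : Type*} [Group P] [TopologicalSpace P]
  {ι : Γ →* P}

section Profinite

variable [IsTopologicalGroup P] [CompactSpace P] [TotallyDisconnectedSpace P]

/-! ### The contradiction from a basis character -/

/-- **No basis character on a pro-`Σ` surface group, genus `≥ 3` level.**  Let `Γ ≅ S_g` (`g ≥ 2`),
`ι : Γ → P` a pro-`Σ` completion (`P` profinite), `p ∈ Σ`, `U ⊆ P` open with `[Γ : ι⁻¹(U)] ≥ 2`, `τ, κ ∈ U`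
COMMUTING, and `ψ : U → 𝔽_p × 𝔽_p` continuous with `ψτ = (1,0)`, `ψκ = (0,1)`.  Then `False`: by F_cov
`ι⁻¹(U) ≅ S_{h'}` with `h' ≥ 3`; the components of `ψ` give value vectors `u₀, v₀` with
`(E₁,E₂)`-values `(1,0)`, `(0,1)`; the isotropic-pair lemma gives such a pair `u, v` with vanishing
Heisenberg obstruction; the pair character lifts to the extraspecial group `E` of order `p³`
(`exists_extraspecial_lift_card`), the lift extends continuously to `U` (`exists_continuous_extend`), its
composite with `E → 𝔽_p²` has components `F_u, F_v` (uniqueness), so `θτ`, `θκ` are commuting lifts of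
`(1,0)`, `(0,1)` — impossible. [cite: MochizukiAbsAnab2004, Lemma 1.3.1 p.15] -/
theorem false_of_basisCharacter_of_two_le_index (hF : SurfaceGroupFiniteIndexSubgroup) {g : ℕ}
    (hg : 2 ≤ g) (e : Γ ≃* SurfaceGroup g) (hι : IsProSigmaCompletion Sigma ι) {p : ℕ}
    [hp : Fact p.Prime] (hpS : p ∈ Sigma) (U : Subgroup P) (hU : IsOpen (U : Set P)) {τ κ : P}
    (hτ : τ ∈ U) (hκ : κ ∈ U) (hidx : 2 ≤ (U.comap ι).index) (hc : τ * κ = κ * τ)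
    (ψ : U →* Multiplicative (ZMod p) × Multiplicative (ZMod p)) (hψc : Continuous ψ)
    (hψτ : ψ ⟨τ, hτ⟩ = (ofAdd 1, 1)) (hψκ : ψ ⟨κ, hκ⟩ = (1, ofAdd 1)) : False := by
  classical
  haveI : NeZero p := ⟨hp.out.ne_zero⟩
  obtain ⟨h', hh', e', Fext, E₁, E₂, hFc, hFext, huniq, hE₁, hE₂⟩ :=
    exists_characterSpace hF hg e hι hpS U hU hτ hκ
  -- genus `≥ 3`
  have hh3 : 3 ≤ h' := by
    have h2 : 2 * 1 ≤ (U.comap ι).index * (g - 1) := Nat.mul_le_mul hidx (by omega)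
    omega
  -- the components of `ψ`, restricted to `ι⁻¹(U)` and transported to `S_{h'}`
  let ιU : U.comap ι →* U := (ι.comp (U.comap ι).subtype).codRestrict U fun x => x.2
  have hιU : ∀ γ (hγ : γ ∈ U.comap ι), ιU ⟨γ, hγ⟩ = ⟨ι γ, hγ⟩ := fun γ hγ => rfl
  let χ₁ : SurfaceGroup h' →* Multiplicative (ZMod p) :=
    (((MonoidHom.fst _ _).comp ψ).comp ιU).comp e'.symm.toMonoidHom
  let χ₂ : SurfaceGroup h' →* Multiplicative (ZMod p) :=
    (((MonoidHom.snd _ _).comp ψ).comp ιU).comp e'.symm.toMonoidHom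
  let u₀ : surfaceGen h' → ZMod p := fun x => toAdd (χ₁ (PresentedGroup.of x))
  let v₀ : surfaceGen h' → ZMod p := fun x => toAdd (χ₂ (PresentedGroup.of x))
  have hχ₁ : Literature.Topology.FourManifolds.SurfaceGroup.toCommGroup (fun x => ofAdd (u₀ x)) = χ₁ := by
    rw [SurfaceGroup.character_eq_toCommGroup χ₁]
    rfl
  have hχ₂ : Literature.Topology.FourManifolds.SurfaceGroup.toCommGroup (fun x => ofAdd (v₀ x)) = χ₂ := by
    rw [SurfaceGroup.character_eq_toCommGroup χ₂]
    rfl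
  have hχ₁γ : ∀ γ (hγ : γ ∈ U.comap ι), χ₁ (e' ⟨γ, hγ⟩) = (ψ ⟨ι γ, hγ⟩).1 := by
    intro γ hγ
    change (ψ (ιU (e'.symm (e' ⟨γ, hγ⟩)))).1 = _
    simp only [MulEquiv.symm_apply_apply, hιU]
  have hχ₂γ : ∀ γ (hγ : γ ∈ U.comap ι), χ₂ (e' ⟨γ, hγ⟩) = (ψ ⟨ι γ, hγ⟩).2 := by
    intro γ hγ
    change (ψ (ιU (e'.symm (e' ⟨γ, hγ⟩)))).2 = _
    simp only [MulEquiv.symm_apply_apply, hιU]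
  have hFu₀ : (MonoidHom.fst _ _).comp ψ = Fext u₀ :=
    huniq u₀ _ (continuous_fst.comp hψc) fun γ hγ => by
      rw [hχ₁, MonoidHom.comp_apply, MonoidHom.coe_fst, hχ₁γ]
  have hFv₀ : (MonoidHom.snd _ _).comp ψ = Fext v₀ :=
    huniq v₀ _ (continuous_snd.comp hψc) fun γ hγ => by
      rw [hχ₂, MonoidHom.comp_apply, MonoidHom.coe_snd, hχ₂γ]
  have hu₁ : E₁ u₀ = 1 := by
    have h1 := hE₁ u₀
    rw [← hFu₀, MonoidHom.comp_apply, MonoidHom.coe_fst, hψτ] at h1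
    exact (toAdd_ofAdd (E₁ u₀)).symm.trans (by rw [← h1, toAdd_ofAdd])
  have hu₂ : E₂ u₀ = 0 := by
    have h1 := hE₂ u₀
    rw [← hFu₀, MonoidHom.comp_apply, MonoidHom.coe_fst, hψκ] at h1
    exact (toAdd_ofAdd (E₂ u₀)).symm.trans (by rw [← h1]; rfl)
  have hv₁ : E₁ v₀ = 0 := by
    have h1 := hE₁ v₀
    rw [← hFv₀, MonoidHom.comp_apply, MonoidHom.coe_snd, hψτ] at h1
    exact (toAdd_ofAdd (E₁ v₀)).symm.trans (by rw [← h1]; rfl)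
  have hv₂ : E₂ v₀ = 1 := by
    have h1 := hE₂ v₀
    rw [← hFv₀, MonoidHom.comp_apply, MonoidHom.coe_snd, hψκ] at h1
    exact (toAdd_ofAdd (E₂ v₀)).symm.trans (by rw [← h1, toAdd_ofAdd])
  -- an isotropic pair with the same evaluation values
  obtain ⟨u, v, hu1, hu2, hv1, hv2, hω⟩ := exists_pair_symplZMod_eq_zero hh3 E₁ E₂ u₀ v₀ hu₁ hu₂ hv₁ hv₂
  -- the pair character and its lift to the extraspecial group
  let Φ : SurfaceGroup h' →* Multiplicative (ZMod p) × Multiplicative (ZMod p) :=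
    (Literature.Topology.FourManifolds.SurfaceGroup.toCommGroup fun x => ofAdd (u x)).prod
      (Literature.Topology.FourManifolds.SurfaceGroup.toCommGroup fun x => ofAdd (v x))
  have hωΦ : (∑ i : Fin h', ((toAdd (Φ (Literature.Topology.FourManifolds.SurfaceGroup.a i)).1) *
      (toAdd (Φ (Literature.Topology.FourManifolds.SurfaceGroup.b i)).2) -
      (toAdd (Φ (Literature.Topology.FourManifolds.SurfaceGroup.a i)).2) *
      (toAdd (Φ (Literature.Topology.FourManifolds.SurfaceGroup.b i)).1))) = 0 := by
    rw [SurfaceGroup.obstruction_eq_symplZMod]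
    exact hω
  obtain ⟨E, _, _, α, hcard, hE, hlift⟩ := exists_extraspecial_lift_card p
  obtain ⟨θS, hθS⟩ := hlift h' Φ hωΦ
  -- extend `θS ∘ e'` continuously to `U`
  letI : TopologicalSpace E := ⊥
  haveI : DiscreteTopology E := ⟨rfl⟩
  have hQE : IsSigmaInteger Sigma (Nat.card E) := by
    rw [hcard]
    exact isSigmaInteger_prime_pow hp.out hpS 3
  obtain ⟨θ, hθc, hθ⟩ := exists_continuous_extend hι U hU hQE (θS.comp e'.toMonoidHom)
  -- the components of `α ∘ θ` are `F_u`, `F_v`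
  have hαc : Continuous fun x : E => α x := continuous_of_discreteTopology
  have hαθc : Continuous fun x : U => α (θ x) := hαc.comp hθc
  have h1 : (MonoidHom.fst _ _).comp (α.comp θ) = Fext u :=
    huniq u _ (continuous_fst.comp hαθc) fun γ hγ => by
      rw [MonoidHom.comp_apply, MonoidHom.coe_fst, MonoidHom.comp_apply, hθ γ hγ, MonoidHom.comp_apply,
        hθS]
      rfl
  have h2 : (MonoidHom.snd _ _).comp (α.comp θ) = Fext v :=
    huniq v _ (continuous_snd.comp hαθc) fun γ hγ => by
      rw [MonoidHom.comp_apply, MonoidHom.coe_snd, MonoidHom.comp_apply, hθ γ hγ, MonoidHom.comp_apply,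
        hθS]
      rfl
  have hατ : α (θ ⟨τ, hτ⟩) = (ofAdd 1, 1) := by
    refine Prod.ext ?_ ?_
    · change ((MonoidHom.fst _ _).comp (α.comp θ)) ⟨τ, hτ⟩ = ofAdd 1
      rw [h1, hE₁, hu1]
    · change ((MonoidHom.snd _ _).comp (α.comp θ)) ⟨τ, hτ⟩ = 1
      rw [h2, hE₁, hv1, ofAdd_zero]
  have hακ : α (θ ⟨κ, hκ⟩) = (1, ofAdd 1) := by
    refine Prod.ext ?_ ?_
    · change ((MonoidHom.fst _ _).comp (α.comp θ)) ⟨κ, hκ⟩ = 1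
      rw [h1, hE₂, hu2, ofAdd_zero]
    · change ((MonoidHom.snd _ _).comp (α.comp θ)) ⟨κ, hκ⟩ = ofAdd 1
      rw [h2, hE₂, hv2]
  have hcomm : θ ⟨τ, hτ⟩ * θ ⟨κ, hκ⟩ = θ ⟨κ, hκ⟩ * θ ⟨τ, hτ⟩ := by
    rw [← map_mul, ← map_mul]
    exact congrArg θ (Subtype.ext hc)
  exact hE _ _ hατ hακ hcomm

/-- **No basis character on a pro-`Σ` surface group** (any open level): as
`false_of_basisCharacter_of_two_le_index`, without the index hypothesis — first shrink `U` by
`exists_shrink`, then restrict `ψ`. [cite: MochizukiAbsAnab2004, Lemma 1.3.1 p.15] -/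
theorem false_of_basisCharacter (hF : SurfaceGroupFiniteIndexSubgroup) {g : ℕ}
    (hg : 2 ≤ g) (e : Γ ≃* SurfaceGroup g) (hι : IsProSigmaCompletion Sigma ι) {p : ℕ}
    [Fact p.Prime] (hpS : p ∈ Sigma) (U : Subgroup P) (hU : IsOpen (U : Set P)) {τ κ : P}
    (hτ : τ ∈ U) (hκ : κ ∈ U) (hc : τ * κ = κ * τ)
    (ψ : U →* Multiplicative (ZMod p) × Multiplicative (ZMod p)) (hψc : Continuous ψ)
    (hψτ : ψ ⟨τ, hτ⟩ = (ofAdd 1, 1)) (hψκ : ψ ⟨κ, hκ⟩ = (1, ofAdd 1)) : False := by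
  obtain ⟨U', hU'le, hU'o, hτ', hκ', hidx⟩ := exists_shrink hF hg e hι hpS U hU hτ hκ
  let ψ' : U' →* Multiplicative (ZMod p) × Multiplicative (ZMod p) := ψ.comp (Subgroup.inclusion hU'le)
  have hψ'c : Continuous ψ' := hψc.comp (continuous_inclusion hU'le)
  exact false_of_basisCharacter_of_two_le_index hF hg e hι hpS U' hU'o hτ' hκ' hidx hc ψ' hψ'c hψτ hψκ

/-! ### Center-freeness and slimness of pro-`Σ` completions of closed surface groups -/

/-- The coordinate characters of a surface group: the integer character `S_g → ℤ` taking the value `1` on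
the generator `x₀` and `0` on the others (a coordinate of the abelianisation `S_g ↠ ℤ^{2g}`).
[cite: HatcherAT2002, §1.2 p. 51] -/
theorem exists_coordinate_character (g : ℕ) (x₀ : surfaceGen g) :
    ∃ d : SurfaceGroup g →* Multiplicative ℤ, ∀ x : surfaceGen g,
      d (PresentedGroup.of x) = if x = x₀ then ofAdd 1 else 1 := by
  classical
  exact ⟨Literature.Topology.FourManifolds.SurfaceGroup.toCommGroup fun x => if x = x₀ then ofAdd 1 else 1,
    fun x => Literature.Topology.FourManifolds.SurfaceGroup.toCommGroup_of _ x⟩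

/-- **The pro-`Σ` completion of a closed surface group of genus `≥ 2` is center-free, modulo F_cov.**
For `Γ ≅ S_g`, `g ≥ 2`, and `ι : Γ → P` a pro-`Σ` completion with `P` profinite: `Z(P) = 1`.  (A central
`z ≠ 1` gives, by separation and the basis character for the generators `a₁, b₁` and their coordinate
characters, the data refuted by `false_of_basisCharacter`.) [cite: MochizukiAbsAnab2004, Lemma 1.3.1 p.15] -/
theorem center_eq_bot_of_surfaceGroup [T2Space P] (hF : SurfaceGroupFiniteIndexSubgroup) {g : ℕ}
    (hg : 2 ≤ g) (e : Γ ≃* SurfaceGroup g) (hι : IsProSigmaCompletion Sigma ι) :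
    Subgroup.center P = ⊥ := by
  classical
  rw [eq_bot_iff]
  intro z hz
  rw [Subgroup.mem_bot]
  by_contra hz1
  have hg0 : 0 < g := by omega
  let i₀ : Fin g := ⟨0, hg0⟩
  -- the generators `a₁ = (i₀, false)`, `b₁ = (i₀, true)` pulled back to `Γ`, with coordinate characters
  obtain ⟨d₁', hd₁'⟩ := exists_coordinate_character g (i₀, false)
  obtain ⟨d₂', hd₂'⟩ := exists_coordinate_character g (i₀, true)
  let a₁ : Γ := e.symm (PresentedGroup.of (i₀, false))
  let a₂ : Γ := e.symm (PresentedGroup.of (i₀, true))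
  let d₁ : Γ →* Multiplicative ℤ := d₁'.comp e.toMonoidHom
  let d₂ : Γ →* Multiplicative ℤ := d₂'.comp e.toMonoidHom
  have hne : ((i₀, true) : surfaceGen g) ≠ (i₀, false) := by simp
  have h11 : d₁ a₁ = ofAdd 1 := by
    change d₁' (e (e.symm _)) = _
    rw [MulEquiv.apply_symm_apply, hd₁', if_pos rfl]
  have h21 : d₂ a₁ = 1 := by
    change d₂' (e (e.symm _)) = _
    rw [MulEquiv.apply_symm_apply, hd₂', if_neg hne.symm]
  have h22 : d₂ a₂ = ofAdd 1 := by
    change d₂' (e (e.symm _)) = _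
    rw [MulEquiv.apply_symm_apply, hd₂', if_pos rfl]
  obtain ⟨a, d, hda, N, hsep⟩ := exists_openNormal_not_mem_zpowers_of_characters hι d₁ d₂ h11 h21 h22 hz1
  haveI : (N : Subgroup P).Normal := N.isNormal'
  have hcz : ι a * z = z * ι a := (Subgroup.mem_center_iff.mp hz) (ι a)
  obtain ⟨p, hp, hpS, U, hUo, κ, hτU, hκU, hc, ψ, hψc, hψτ, hψκ⟩ :=
    exists_basisCharacter_of_not_mem_zpowers hι (N : Subgroup P) N.isOpen' d hda hcz hsep
  exact false_of_basisCharacter hF hg e hι hpS U hUo hτU hκU hc ψ hψc hψτ hψκ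

/-- **[AbsAnab] Lemma 1.3.1, PROPER case, pro-`Σ`, modulo F_cov: the pro-`Σ` completion of a closed surface
group of genus `≥ 2` is SLIM** — for `Γ ≅ S_g` (`g ≥ 2`) and `ι : Γ → P` a pro-`Σ` completion (`P`
profinite), the centraliser of every open subgroup of `P` is trivial.  (Oort's reduction: for `H` open and
`z ∈ Z_P(H)`, `z` is central in the open `W = ⟨H, z⟩`; `ι⁻¹(W)` has finite index in `Γ ≅ S_g`, hence is an
`S_h`, `h ≥ 2`, by F_cov, and `ι⁻¹(W) → W` is a pro-`Σ` completion (abc-iut-L5-t9's `restrict_isOpen`), so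
`center_eq_bot_of_surfaceGroup` applies.) [cite: MochizukiAbsAnab2004, Lemma 1.3.1 p.15] -/
theorem isSlimGroup_of_surfaceGroup [T2Space P] (hF : SurfaceGroupFiniteIndexSubgroup) {g : ℕ}
    (hg : 2 ≤ g) (e : Γ ≃* SurfaceGroup g) (hι : IsProSigmaCompletion Sigma ι) : IsSlimGroup P := by
  classical
  refine ⟨fun H hH => ?_⟩
  rw [eq_bot_iff]
  intro z hz
  rw [Subgroup.mem_bot]
  -- `W = ⟨H, z⟩` is open and `z` is central in `W`
  let W : Subgroup P := H ⊔ Subgroup.zpowers z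
  have hWo : IsOpen (W : Set P) := Subgroup.isOpen_mono le_sup_left hH
  have hzW : z ∈ W := Subgroup.mem_sup_right (Subgroup.mem_zpowers z)
  have hle : W ≤ Subgroup.centralizer {z} :=
    sup_le (fun h hh => Subgroup.mem_centralizer_singleton_iff.mpr (Subgroup.mem_centralizer_iff.mp hz h hh))
      ((Subgroup.zpowers_le).mpr (Subgroup.mem_centralizer_singleton_iff.mpr rfl))
  have hzc : ∀ w ∈ W, w * z = z * w := fun w hw => Subgroup.mem_centralizer_singleton_iff.mp (hle hw)
  -- `ι⁻¹(W) → W` is a pro-`Σ` completion of a surface group of genus `≥ 2` (F_cov)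
  have hιW := restrict_isOpen hι W hWo
  haveI : CompactSpace W := isCompact_iff_compactSpace.mp (W.isClosed_of_isOpen hWo).isCompact
  haveI hWfi : (W.comap ι).FiniteIndex := finiteIndex_comap hι W hWo
  let K : Subgroup (SurfaceGroup g) := (W.comap ι).map (e : Γ →* SurfaceGroup g)
  have hKidx : K.index = (W.comap ι).index := Subgroup.index_map_equiv _ e
  have hKfi : K.FiniteIndex := ⟨by rw [hKidx]; exact hWfi.index_ne_zero⟩
  obtain ⟨h, hh, ⟨e₂⟩⟩ := hF g hg K hKfi
  have hh2 : 2 ≤ h := two_le_genus_of_index hg hKfi.index_ne_zero hh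
  let eW : W.comap ι ≃* SurfaceGroup h := (e.subgroupMap (W.comap ι)).trans e₂
  have hcen : (⟨z, hzW⟩ : W) ∈ Subgroup.center W :=
    Subgroup.mem_center_iff.mpr fun w => Subtype.ext (hzc w w.2)
  rw [center_eq_bot_of_surfaceGroup hF hh2 eW hιW, Subgroup.mem_bot] at hcen
  exact congrArg Subtype.val hcen

end Profinite

/-! ### The closed-surface case `h0` of `ProSigmaSurfaceGroupSlim`, and the named facts modulo F_cov -/

/-- **`h0` modulo F_cov**: for every nonempty set of primes `Σ` (only `p ∈ Σ ⇒ p` prime is used) and every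
`g ≥ 2`, every pro-`Σ` completion of the closed surface group `Γ_{g,0}` is slim — the hypothesis `h0` of
abc-iut-L5-t9's `proSigmaSurfaceGroupSlim_of_closed`, PROVED from the named fact
`SurfaceGroupFiniteIndexSubgroup`. [cite: MochizukiAbsAnab2004, Lemma 1.3.1 p.15] -/
theorem isSlimGroup_of_isProSigmaCompletion_closedSurfaceGroup (hF : SurfaceGroupFiniteIndexSubgroup)
    (Sigma : Set ℕ) (g : ℕ) (hg : 2 ≤ g)
    (P : Type u) [Group P] [TopologicalSpace P] [IsTopologicalGroup P] [CompactSpace P]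
    [T2Space P] [TotallyDisconnectedSpace P] (ι : PuncturedSurfaceGroup g 0 →* P)
    (hι : IsProSigmaCompletion Sigma ι) : IsSlimGroup P := by
  obtain ⟨e⟩ := nonempty_mulEquiv_puncturedSurfaceGroup_zero g
  exact isSlimGroup_of_surfaceGroup hF hg e hι

/-- **`ProSigmaSurfaceGroupSlim` modulo F_cov** (abc-iut-L3-t11's named fact, [AbsAnab] Lemma 1.3.1 in
pro-`Σ` form for all hyperbolic `(g, r)`): the punctured case is abc-iut-L5-t9's
`isSlimGroup_of_isProSigmaCompletion_puncturedSurfaceGroup`, the closed case is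
`isSlimGroup_of_isProSigmaCompletion_closedSurfaceGroup`.  CONDITIONAL on the named fact
`SurfaceGroupFiniteIndexSubgroup` only. [cite: MochizukiAbsAnab2004, Lemma 1.3.1 p.15] -/
theorem proSigmaSurfaceGroupSlim_of_finiteIndexSubgroup (hF : SurfaceGroupFiniteIndexSubgroup) :
    ProSigmaSurfaceGroupSlim.{u} :=
  proSigmaSurfaceGroupSlim_of_closed fun Sigma _ _ g hg P _ _ _ _ _ _ ι hι =>
    isSlimGroup_of_isProSigmaCompletion_closedSurfaceGroup hF Sigma g hg P ι hι

/-- **[SemiAnbd] Example 2.10, conjunct (5), modulo F_cov only**: every semi-graph of anabelioids of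
surface type is verticially slim (abc-iut-L3-t11's `example_2_10_verticiallySlim_of` composed with
`proSigmaSurfaceGroupSlim_of_finiteIndexSubgroup`). [cite: MochizukiSemiAnbd2006, Ex. 2.10 p.31] -/
theorem example_2_10_verticiallySlim_of_finiteIndexSubgroup (hF : SurfaceGroupFiniteIndexSubgroup)
    (𝒢 : SemiGraphOfAnabelioids.{v₁, u₁, u}) (Sigma : Set ℕ) (hS : 𝒢.IsOfSurfaceType Sigma) :
    𝒢.IsVerticiallySlim :=
  example_2_10_verticiallySlim_of (proSigmaSurfaceGroupSlim_of_finiteIndexSubgroup hF) 𝒢 Sigma hS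

end Literature.AnabelianGeometry.SemiGraphs.SemiGraphOfAnabelioids.IsProSigmaCompletion

end
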